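import Literature.Analysis.FunctionSpaces.LorentzPQ
import HarnessLib

/-!
# The diagonal of the Lorentz scale: `L^{p,p} = L^p`

Analysis/FunctionSpaces file, companion of `LorentzPQ.lean` (the distribution-function form
`eLorentzNormPow f p q μ = ∫₀^∞ t^{q-1} μ{|f| > t}^{q/p} dt = p⁻¹ ‖f‖^q_{L^{p,q}}`).  On the
diagonal `q = p` the Lorentz functional is the Lebesgue one: by the layer-cake formula
`∫ |f|^p dμ = p ∫₀^∞ t^{p-1} μ{|f| > t} dt` (Grafakos, *Classical Fourier Analysis*, 3rd ed.,
Prop. 1.1.4), `eLorentzNormPow f p p μ = p⁻¹ ∫ |f|^p dμ = p⁻¹ ‖f‖^p_{L^p}`, i.e.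
`‖f‖_{L^{p,p}} = ‖f‖_{L^p}` (Grafakos, Prop. 1.4.5 (14) / remark after Def. 1.4.6:
`L^{p,p} = L^p`).  Consumers: the `q = 3` slice of the Lorentz regularity criterion
`Literature.Analysis.FluidPDE.hasSmoothExtensionPast_of_eLorentzNormPow_bounded` is the `L³`
criterion (`L^{3,3} = L³`; census `pub/ns-census` row F8′).

Proved here (Mathlib's layer-cake theorem `MeasureTheory.lintegral_rpow_eq_lintegral_meas_lt_mul`):
* `eLorentzNormPow_self_eq_lintegral` — `eLorentzNormPow f p p μ = (p)⁻¹ · ∫⁻ ‖f‖ₑ^p`;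
* `eLorentzNormPow_self_eq_eLpNorm_rpow` — `= (p)⁻¹ · (eLpNorm f p μ)^p`;
* `eLpNorm_rpow_eq_mul_eLorentzNormPow_self` — the same read backwards;
* `eLorentzNormPow_self_lt_top_iff`, `memLorentz_self_iff_memLp` — `L^{p,p} = L^p` as spaces.
All for `0 < p < ∞` and a.e.-strongly measurable `f` (the layer-cake formula needs measurability).

## Mathlib / tree search

`lean search 'Lorentz'` (2026-08-28): tree `LorentzOne.lean` (`q = 1`), `LorentzPQ.lean`
(general `q`, no diagonal lemma), `WeakLp.lean` (`q = ∞`); Mathlib: `eLpNorm`, layer cake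
(`Mathlib/Analysis/SpecialFunctions/Pow/Integral.lean`).

## References

* L. Grafakos, *Classical Fourier Analysis*, 3rd ed., GTM 249 (2014), Prop. 1.1.4 (layer cake),
  §1.4.2 Def. 1.4.6 and the identity `L^{p,p} = L^p`, Prop. 1.4.9. [Grafakos2014]
-/

noncomputable section

open MeasureTheory Set Function Filter
open scoped ENNReal NNReal Topology

namespace Literature.Analysis.FunctionSpaces

variable {α : Type*} [MeasurableSpace α] {E : Type*} [NormedAddCommGroup E]
variable {f : α → E} {p : ℝ≥0∞} {μ : Measure α}

/-- **`L^{p,p} = L^p` at the level of the functional**: for `0 < p < ∞` and a.e.-strongly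
measurable `f`, `eLorentzNormPow f p p μ = p⁻¹ ∫ ‖f‖^p dμ` (layer-cake formula, Grafakos
Prop. 1.1.4, inserted in the distribution-function form Prop. 1.4.9 at `q = p`).
[cite: Grafakos2014, Prop. 1.1.4 and §1.4.2 (L^{p,p} = L^p)] -/
theorem eLorentzNormPow_self_eq_lintegral (hf : AEStronglyMeasurable f μ) (hp0 : p ≠ 0)
    (hptop : p ≠ ∞) :
    eLorentzNormPow f p p μ = (ENNReal.ofReal p.toReal)⁻¹ * ∫⁻ x, ‖f x‖ₑ ^ p.toReal ∂μ := by
  have hp : 0 < p.toReal := ENNReal.toReal_pos hp0 hptop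
  have hnn : 0 ≤ᵐ[μ] fun x => ‖f x‖ := Eventually.of_forall fun x => norm_nonneg _
  have hmeas : AEMeasurable (fun x => ‖f x‖) μ := hf.norm.aemeasurable
  have hcake := lintegral_rpow_eq_lintegral_meas_lt_mul μ hnn hmeas hp
  have hlhs : ∫⁻ x, ENNReal.ofReal (‖f x‖ ^ p.toReal) ∂μ = ∫⁻ x, ‖f x‖ₑ ^ p.toReal ∂μ := by
    refine lintegral_congr fun x => ?_
    rw [← ENNReal.ofReal_rpow_of_nonneg (norm_nonneg _) hp.le, ofReal_norm]
  have hp' : ENNReal.ofReal p.toReal ≠ 0 := (ENNReal.ofReal_pos.mpr hp).ne'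
  rw [eLorentzNormPow_eq_lintegral_setOf_lt_norm, div_self hp.ne', ← hlhs, hcake, ← mul_assoc,
    ENNReal.inv_mul_cancel hp' ENNReal.ofReal_ne_top, one_mul]
  refine setLIntegral_congr_fun measurableSet_Ioi fun t _ => ?_
  rw [ENNReal.rpow_one, mul_comm]

/-- **`L^{p,p} = L^p` through `eLpNorm`**: for `0 < p < ∞` and a.e.-strongly measurable `f`,
`eLorentzNormPow f p p μ = p⁻¹ · (eLpNorm f p μ)^p` (Grafakos, §1.4.2: `‖f‖_{L^{p,p}} = ‖f‖_{L^p}`).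
[cite: Grafakos2014, §1.4.2 (L^{p,p} = L^p) with Prop. 1.4.9] -/
theorem eLorentzNormPow_self_eq_eLpNorm_rpow (hf : AEStronglyMeasurable f μ) (hp0 : p ≠ 0)
    (hptop : p ≠ ∞) :
    eLorentzNormPow f p p μ = (ENNReal.ofReal p.toReal)⁻¹ * eLpNorm f p μ ^ p.toReal := by
  have hp : 0 < p.toReal := ENNReal.toReal_pos hp0 hptop
  rw [eLorentzNormPow_self_eq_lintegral hf hp0 hptop,
    eLpNorm_eq_lintegral_rpow_enorm_toReal hp0 hptop, ← ENNReal.rpow_mul,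
    one_div_mul_cancel hp.ne', ENNReal.rpow_one]

/-- **`‖f‖^p_{L^p} = p · eLorentzNormPow f p p μ`** (`0 < p < ∞`, `f` a.e.-strongly measurable;
Grafakos, §1.4.2: `L^{p,p} = L^p`). [cite: Grafakos2014, §1.4.2 (L^{p,p} = L^p) with Prop. 1.4.9] -/
theorem eLpNorm_rpow_eq_mul_eLorentzNormPow_self (hf : AEStronglyMeasurable f μ) (hp0 : p ≠ 0)
    (hptop : p ≠ ∞) :
    eLpNorm f p μ ^ p.toReal = ENNReal.ofReal p.toReal * eLorentzNormPow f p p μ := by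
  have hp : 0 < p.toReal := ENNReal.toReal_pos hp0 hptop
  have hp' : ENNReal.ofReal p.toReal ≠ 0 := (ENNReal.ofReal_pos.mpr hp).ne'
  rw [eLorentzNormPow_self_eq_eLpNorm_rpow hf hp0 hptop, ← mul_assoc,
    ENNReal.mul_inv_cancel hp' ENNReal.ofReal_ne_top, one_mul]

/-- **Finiteness on the diagonal**: for `0 < p < ∞` and a.e.-strongly measurable `f`,
`eLorentzNormPow f p p μ < ∞ ↔ eLpNorm f p μ < ∞` (Grafakos, §1.4.2: `L^{p,p} = L^p`).
[cite: Grafakos2014, §1.4.2 (L^{p,p} = L^p)] -/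
theorem eLorentzNormPow_self_lt_top_iff (hf : AEStronglyMeasurable f μ) (hp0 : p ≠ 0)
    (hptop : p ≠ ∞) :
    eLorentzNormPow f p p μ < ∞ ↔ eLpNorm f p μ < ∞ := by
  have hp : 0 < p.toReal := ENNReal.toReal_pos hp0 hptop
  have hp' : ENNReal.ofReal p.toReal ≠ 0 := (ENNReal.ofReal_pos.mpr hp).ne'
  rw [eLorentzNormPow_self_eq_eLpNorm_rpow hf hp0 hptop]
  constructor
  · intro h
    have h' : eLpNorm f p μ ^ p.toReal < ∞ := by
      have := ENNReal.mul_lt_top (ENNReal.ofReal_lt_top (r := p.toReal)) h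
      rwa [← mul_assoc, ENNReal.mul_inv_cancel hp' ENNReal.ofReal_ne_top, one_mul] at this
    exact (ENNReal.rpow_lt_top_iff_of_pos hp).mp h'
  · intro h
    exact ENNReal.mul_lt_top (ENNReal.inv_lt_top.mpr (ENNReal.ofReal_pos.mpr hp))
      (ENNReal.rpow_lt_top_of_nonneg hp.le h.ne)

/-- **`L^{p,p} = L^p` as spaces**: for `0 < p < ∞`, `MemLorentz f p p μ ↔ MemLp f p μ`
(Grafakos, §1.4.2). [cite: Grafakos2014, §1.4.2 (L^{p,p} = L^p)] -/
theorem memLorentz_self_iff_memLp (hp0 : p ≠ 0) (hptop : p ≠ ∞) :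
    MemLorentz f p p μ ↔ MemLp f p μ := by
  constructor
  · rintro ⟨hf, h⟩
    exact ⟨hf, (eLorentzNormPow_self_lt_top_iff hf hp0 hptop).mp h⟩
  · rintro ⟨hf, h⟩
    exact ⟨hf, (eLorentzNormPow_self_lt_top_iff hf hp0 hptop).mpr h⟩

end Literature.Analysis.FunctionSpaces

end
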